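import Literature.Probability.LatticeModels.BalabanStepOneFormatXYBonds

/-!
# Balaban's step-one format — symmetries of the total small-field action and GAUSSIAN REALITY

For a quasi-local small-field action `A` of
`Literature.Probability.LatticeModels.BalabanStepOne.QuasiLocalAction` (route BalabanIR of
`HubbardSuperconductivity`, crux `BirFormatEngine`), the TOTAL ACTION `S z = Σ_X A X z` inherits the
clause-wise symmetries (`sum_transl`, `sum_inversion`, `sum_reflHerm`, `sum_const`): it is translation
and inversion invariant, vanishes at constants, and is (R)-Hermitian, `S (z ∘ R) = conj (S (conj ∘ z))`;
in particular on REAL configurations `Im S` is odd and `Re S` even under the time reflection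
(`im_sum_timeRefl`).

**Gaussian reality, derivative-free.**  The structural fact every seat on the cruxes 2R/4R re-derived
informally — "(R) ∧ (P) ∧ translation invariance force the imaginary part of the quadratic form of the
action at the aligned configuration to vanish, so the Gaussian approximation of a complex format member
is REAL" — is recorded here as two exact identities that need no calculus:

* `im_sum_single` — `Im S (a·δ_s) = 0` for every site `s` and amplitude `a` (translation invariance
  makes it independent of `s`, (R) makes it odd under `s ↦ R s`);
* `im_sum_single_add_single` — `Im S (a·δ_s + a·δ_{s'}) = 0` for all `s, s'` and `a`: the symmetric
  second difference `β(d) = Im S (a δ_0 + a δ_d)` is even (`d ↦ -d`, by translation + symmetry),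
  (P)-even and (R)-odd, and `-d = P (R d)` up to the order of the factors, whence `β = -β`.

Dividing by `a²` and letting `a → 0` (for whoever holds the calculus) these say that the Hessian of
`Im S` at the aligned configuration vanishes identically: all pure and all mixed second partials.
Folklore; no fact about any engine is asserted.
-/

noncomputable section

open scoped BigOperators Classical ComplexConjugate
open Finset

namespace Literature.Probability.LatticeModels.BalabanStepOne

variable {L' M : ℕ} [NeZero L'] [NeZero M]
variable {K B κ : ℝ} {A : Finset (Site L' M) → (Site L' M → ℂ) → ℂ}

/-! ### Symmetries of the total action -/

/-- Re-indexing the sum over all site sets by the image under a permutation of the sites. [folklore] -/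
theorem sum_comp_image_equiv (e : Site L' M ≃ Site L' M) (F : Finset (Site L' M) → ℂ) :
    ∑ X : Finset (Site L' M), F (X.image e) = ∑ X : Finset (Site L' M), F X := by
  have h : ∀ X : Finset (Site L' M), X.image e = Equiv.finsetCongr e X := fun X => by
    rw [Equiv.finsetCongr_apply, Finset.map_eq_image]
    rfl
  simp_rw [h]
  exact Equiv.sum_comp (Equiv.finsetCongr e) F

/-- The total action is translation invariant. [folklore] -/
theorem QuasiLocalAction.sum_transl (h : QuasiLocalAction K B κ L' M A) (z : Site L' M → ℂ) (t : Site L' M) :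
    ∑ X : Finset (Site L' M), A X (fun s => z (s + t)) = ∑ X : Finset (Site L' M), A X z := by
  rw [show (∑ X : Finset (Site L' M), A X (fun s => z (s + t))) =
      ∑ X : Finset (Site L' M), A (X.image (· + t)) z from sum_congr rfl fun X _ => (h.transl X t z).symm]
  exact sum_comp_image_equiv (Equiv.addRight t) fun X => A X z

/-- The total action is inversion invariant. [folklore] -/
theorem QuasiLocalAction.sum_inversion (h : QuasiLocalAction K B κ L' M A) (z : Site L' M → ℂ) :
    ∑ X : Finset (Site L' M), A X (fun s => z (spaceInv s)) = ∑ X : Finset (Site L' M), A X z := by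
  rw [← sum_comp_image_equiv spaceInvEquiv fun X => A X (fun s => z (spaceInv s))]
  exact sum_congr rfl fun X _ => h.inversion X z

/-- The total action is (R)-Hermitian: `S (z ∘ R) = conj (S (conj ∘ z))`. [folklore] -/
theorem QuasiLocalAction.sum_reflHerm (h : QuasiLocalAction K B κ L' M A) (z : Site L' M → ℂ) :
    ∑ X : Finset (Site L' M), A X (fun s => z (timeRefl s)) =
      conj (∑ X : Finset (Site L' M), A X (fun s => conj (z s))) := by
  rw [map_sum, ← sum_comp_image_equiv timeReflEquiv fun X => A X (fun s => z (timeRefl s))]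
  exact sum_congr rfl fun X _ => h.reflHerm X z

/-- The total action vanishes at constant configurations. [folklore] -/
theorem QuasiLocalAction.sum_const (h : QuasiLocalAction K B κ L' M A) (c : ℂ) :
    ∑ X : Finset (Site L' M), A X (fun _ => c) = 0 :=
  sum_eq_zero fun X _ => h.norm0 X c

/-- On real configurations the imaginary part of the total action is ODD under the time reflection.
[folklore] -/
theorem QuasiLocalAction.im_sum_timeRefl (h : QuasiLocalAction K B κ L' M A) (θ : Site L' M → ℝ) :
    (∑ X : Finset (Site L' M), A X (fun s => ((θ (timeRefl s) : ℝ) : ℂ))).im =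
      -(∑ X : Finset (Site L' M), A X (fun s => ((θ s : ℝ) : ℂ))).im := by
  have h1 := h.sum_reflHerm fun s => ((θ s : ℝ) : ℂ)
  simp only [Complex.conj_ofReal] at h1
  rw [h1, Complex.conj_im]

/-- On real configurations the real part of the total action is EVEN under the time reflection.
[folklore] -/
theorem QuasiLocalAction.re_sum_timeRefl (h : QuasiLocalAction K B κ L' M A) (θ : Site L' M → ℝ) :
    (∑ X : Finset (Site L' M), A X (fun s => ((θ (timeRefl s) : ℝ) : ℂ))).re =
      (∑ X : Finset (Site L' M), A X (fun s => ((θ s : ℝ) : ℂ))).re := by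
  have h1 := h.sum_reflHerm fun s => ((θ s : ℝ) : ℂ)
  simp only [Complex.conj_ofReal] at h1
  rw [h1, Complex.conj_re]

/-! ### Gaussian reality, derivative-free -/

omit [NeZero L'] [NeZero M] in
/-- A translated bump is a bump. [folklore] -/
theorem single_comp_add (s t : Site L' M) (a : ℝ) :
    (fun x => (Pi.single s a : Site L' M → ℝ) (x + t)) = Pi.single (s - t) a := by
  funext x
  simp only [Pi.single_apply, eq_sub_iff_add_eq]

omit [NeZero L'] [NeZero M] in
/-- A reflected bump is a bump. [folklore] -/
theorem single_comp_timeRefl (s : Site L' M) (a : ℝ) :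
    (fun x => (Pi.single s a : Site L' M → ℝ) (timeRefl x)) = Pi.single (timeRefl s) a := by
  funext x
  simp only [Pi.single_apply]
  congr 1
  exact propext ⟨fun h => by rw [← h, timeRefl_timeRefl], fun h => by rw [h, timeRefl_timeRefl]⟩

omit [NeZero L'] [NeZero M] in
/-- An inverted bump is a bump. [folklore] -/
theorem single_comp_spaceInv (s : Site L' M) (a : ℝ) :
    (fun x => (Pi.single s a : Site L' M → ℝ) (spaceInv x)) = Pi.single (spaceInv s) a := by
  funext x
  simp only [Pi.single_apply]
  congr 1
  exact propext ⟨fun h => by rw [← h, spaceInv_spaceInv], fun h => by rw [h, spaceInv_spaceInv]⟩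

omit [NeZero L'] [NeZero M] in
/-- Casting a real configuration to a complex one respects equality of configurations. [folklore] -/
theorem cast_cfg_congr {f g : Site L' M → ℝ} (e : f = g) :
    (fun x => ((f x : ℝ) : ℂ)) = fun x => ((g x : ℝ) : ℂ) := by
  rw [e]

/-- **Gaussian reality (i).** `Im S (a·δ_s) = 0`: the imaginary part of the total action vanishes on
every single-site configuration. [folklore] -/
theorem QuasiLocalAction.im_sum_single (h : QuasiLocalAction K B κ L' M A) (s : Site L' M) (a : ℝ) :
    (∑ X : Finset (Site L' M), A X (fun x => ((Pi.single s a : Site L' M → ℝ) x : ℂ))).im = 0 := by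
  -- translation invariance: the value does not depend on the site
  have htr : ∀ s' : Site L' M,
      (∑ X : Finset (Site L' M), A X (fun x => ((Pi.single s' a : Site L' M → ℝ) x : ℂ))).im =
        (∑ X : Finset (Site L' M), A X (fun x => ((Pi.single (0 : Site L' M) a : Site L' M → ℝ) x : ℂ))).im := by
    intro s'
    have h1 := h.sum_transl (fun x => ((Pi.single s' a : Site L' M → ℝ) x : ℂ)) s'
    have h2 : (fun x => ((Pi.single s' a : Site L' M → ℝ) (x + s') : ℂ)) =
        fun x => ((Pi.single (0 : Site L' M) a : Site L' M → ℝ) x : ℂ) := by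
      have e := single_comp_add s' s' a
      rw [sub_self] at e
      exact cast_cfg_congr e
    rw [h2] at h1
    rw [h1]
  -- (R): the value is odd under `s ↦ R s`
  have hR := h.im_sum_timeRefl (Pi.single s a)
  have h3 : (fun x => (((Pi.single s a : Site L' M → ℝ) (timeRefl x) : ℝ) : ℂ)) =
      fun x => ((Pi.single (timeRefl s) a : Site L' M → ℝ) x : ℂ) := by
    exact cast_cfg_congr (single_comp_timeRefl s a)
  rw [h3, htr (timeRefl s), htr s] at hR
  rw [htr s]
  linarith

/-- **Gaussian reality (ii).** `Im S (a·δ_s + a·δ_{s'}) = 0`: the imaginary part of the total action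
vanishes on every symmetric two-site configuration — with (i), the symmetric second difference of
`Im S` at the aligned configuration vanishes, i.e. (after `a → 0`) the Hessian of `Im S` is zero.
[folklore] -/
theorem QuasiLocalAction.im_sum_single_add_single (h : QuasiLocalAction K B κ L' M A) (s s' : Site L' M)
    (a : ℝ) :
    (∑ X : Finset (Site L' M), A X
      (fun x => (((Pi.single s a + Pi.single s' a : Site L' M → ℝ) x : ℝ) : ℂ))).im = 0 := by
  -- β d := Im S (a δ_0 + a δ_d)
  set β : Site L' M → ℝ := fun d => (∑ X : Finset (Site L' M), A X
    (fun x => (((Pi.single (0 : Site L' M) a + Pi.single d a : Site L' M → ℝ) x : ℝ) : ℂ))).im with hβ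
  -- translation: Im S (a δ_u + a δ_v) = β (v - u)
  have htr : ∀ u v : Site L' M, (∑ X : Finset (Site L' M), A X
      (fun x => (((Pi.single u a + Pi.single v a : Site L' M → ℝ) x : ℝ) : ℂ))).im = β (v - u) := by
    intro u v
    have h1 := h.sum_transl (fun x => (((Pi.single u a + Pi.single v a : Site L' M → ℝ) x : ℝ) : ℂ)) u
    have h2 : (fun x => (((Pi.single u a + Pi.single v a : Site L' M → ℝ) (x + u) : ℝ) : ℂ)) =
        fun x => (((Pi.single (0 : Site L' M) a + Pi.single (v - u) a : Site L' M → ℝ) x : ℝ) : ℂ) := by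
      refine cast_cfg_congr ?_
      rw [← sub_self u, ← single_comp_add u u a, ← single_comp_add v u a]
      rfl
    rw [h2] at h1
    simp only [hβ]
    rw [h1]
  -- symmetry ⇒ β even
  have heven : ∀ d : Site L' M, β (-d) = β d := by
    intro d
    have h1 := htr d 0
    have h2 := htr 0 d
    rw [add_comm] at h1
    rw [zero_sub] at h1
    rw [sub_zero] at h2
    rw [← h1, ← h2]
  -- (R) ⇒ β odd under the time reflection
  have hodd : ∀ d : Site L' M, β (timeRefl d) = -β d := by
    intro d
    have hR := h.im_sum_timeRefl (Pi.single (0 : Site L' M) a + Pi.single d a)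
    have h3 : (fun x => (((Pi.single (0 : Site L' M) a + Pi.single d a : Site L' M → ℝ) (timeRefl x) : ℝ) : ℂ)) =
        fun x => (((Pi.single (timeRefl (0 : Site L' M)) a + Pi.single (timeRefl d) a :
          Site L' M → ℝ) x : ℝ) : ℂ) := by
      refine cast_cfg_congr ?_
      rw [← single_comp_timeRefl (0 : Site L' M) a, ← single_comp_timeRefl d a]
      rfl
    have hR0 : timeRefl (0 : Site L' M) = 0 := by ext <;> simp [timeRefl]
    rw [h3, hR0] at hR
    simp only [hβ]
    exact hR
  -- (P) ⇒ β even under the inversion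
  have hinv : ∀ d : Site L' M, β (spaceInv d) = β d := by
    intro d
    have hP := congrArg Complex.im (h.sum_inversion
      (fun x => (((Pi.single (0 : Site L' M) a + Pi.single d a : Site L' M → ℝ) x : ℝ) : ℂ)))
    have h3 : (fun x => (((Pi.single (0 : Site L' M) a + Pi.single d a : Site L' M → ℝ) (spaceInv x) : ℝ) : ℂ)) =
        fun x => (((Pi.single (spaceInv (0 : Site L' M)) a + Pi.single (spaceInv d) a :
          Site L' M → ℝ) x : ℝ) : ℂ) := by
      refine cast_cfg_congr ?_
      rw [← single_comp_spaceInv (0 : Site L' M) a, ← single_comp_spaceInv d a]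
      rfl
    have hP0 : spaceInv (0 : Site L' M) = 0 := by ext <;> simp [spaceInv]
    rw [h3, hP0] at hP
    simp only [hβ]
    exact hP
  -- `-d = P (R d)`-type bookkeeping: β d = β (-d) = β (P (d.1, -d.2)) = β (d.1, -d.2) = β (R d) = -β d
  have hkey : ∀ d : Site L' M, β d = 0 := by
    intro d
    have e1 : (-d : Site L' M) = spaceInv (timeRefl d) := by ext <;> simp [spaceInv, timeRefl]
    have h1 := heven d
    rw [e1, hinv, hodd] at h1
    linarith
  rw [htr s s']
  exact hkey _

end Literature.Probability.LatticeModels.BalabanStepOne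

end
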